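import Summits.Ventures.HSemireg.ObstructionLocusCrossingExtTwo
import Summits.Ventures.HSemireg.ObstructionLocusBlockProjDim

/-!
# Venture HSemireg — (S5) OBSTRUCTION LOCUS away from secant type, XXXVII: EXT-NOTE §6.B(c) IN TOP DEGREE AT
# EVERY CROSSING GERM, KÜNNETH-FREE — `Ext^r_R(I_M, I_M) ≃ₗ[R] Π_{τ} R ⧸ Σ_i (x_{b_i}, x_{a_i})` over the branch
# tuples `τ = ((a_i, b_i))_i` of an `r`-block model, every `r`, every `n`, ANY commutative ring

HONEST FRAMING.  Part of the Lean side of the computation cell `pub-hsemireg` (track «S4-PUSH» (ii), seat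
s4-prove-2).  Plain commutative / homological algebra in `R = MvPolynomial (Fin n) K`, every `n`, EVERY commutative
ring `K`, with Mathlib's derived `CategoryTheory.Abelian.Ext`.  Nothing here constructs a variety or a sheaf; nothing
here says that HC / HC_CM / HC_AV holds; no Literature fact is declared or used; no object is certified.

THE STATEMENT (EXT-NOTE §6.B(c), top degree `q = r`).  For a block model `M = M(S_1, …, S_r)` (file XVI; ideal
`I_M = ⋂_i I_{S_i}`, `r = #blocks`), a BRANCH TUPLE is a choice `τ = (t_i)_i` of one branch datum `t_i = (a_i, b_i)`,
`a_i ∈ S_i`, `b_i ∈ S_i ∖ a_i`, in every block (`BranchTuple`), with ideal `J_τ = Σ_i (x_{b_i}, x_{a_i})` (`tupleIdeal`).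
**`extTopEquiv`**: `Ext^r_R(I_M, I_M) ≃ₗ[R] Π_{τ} R ⧸ J_τ` — «the stalk of `𝓔xt^r(I_Z, I_Z)` at a point through which `r`
translates pass is the POINT ∕ DEEPEST term: rank `Π_i |S_i|(|S_i| − 1)` (`card_branchTuple`) on `⋂_i B_i` for every
choice of one component `B_i ⊂ W + t_i` per translate, and nothing else»; `r = 1` is file XXIX's `𝓔xt¹ = 𝓝′`, `r = 2`
is file XXXV's `extTwoEquivCrossing` (rank `4 = 2·2`), `r = 3` at the triple point `K₂ ⊔ K₂ ⊔ K₂` of `E⁶` is the rank-`8`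
point term (`extEquivOfCardEq`, `extTopEquiv_ofPoint`).  (`𝓔xt^{>r} = 0` there is file XXX's
`ext_arrIdeal_subsingleton_of_card_lt`; the middle degrees `1 < q < r` are NOT treated here.)

THE PROOF (no Künneth formula, no grading), by induction on `r`, peeling one block `S = S_{i₀}`: with `V := I_{M′}`
(`M′` = the other `r − 1` blocks, `pd_R V ≤ r − 1` by file XXX) and the dévissage `0 → V^{S∖a₀} →Φ V^S → I_M → 0`
(files XXVII/XXVIII), BOTH long exact `Ext` sequences degenerate in degree `r` exactly as in file XXXV:
(1) `Ext^r(I_M, I_M) = Ext^{r−1}(V^{S∖a₀}, I_M) ⧸ Φ^*` (file XXXI's cokernel, `Ext^r(V^S, I_M) = 0`);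
(2) `Ext^{r−1}(V, I_M) = Ext^{r−1}(V, V^S) ⧸ Φ_*` (the covariant cokernel, `Ext^r(V, V^{S∖a₀}) = 0`);
(3) on finite powers `Φ^*`, `Φ_*` are the scalar matrices `Φᵀ`, `Φ` (file XXXI) and `Ext^{r−1}(V, V) = Π_{τ′} R ⧸ J_{τ′}`
over the branch tuples of `M′` (INDUCTION);
(4) flattening gives the double cokernel `Y(Π_{τ′} R ⧸ J_{τ′}) = Π_{τ′} Y(R ⧸ J_{τ′})` (file XXXIII) and
`Y(R ⧸ J) = Π_{t ∈ Br(S)} R ⧸ ((x_b, x_a) + J)` is file XXXV's `yQuotEquiv` (base change XXXIV + core XXXII);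
(5) re-index `(t, τ′) ↦ τ`.  Base `r = 0`: `I_M = R`, `Ext⁰_R(R, R) = R`.
References (dictionary only): EXT-NOTE.md §6.A, §6.B(c), §6.D.
-/

open CategoryTheory CategoryTheory.Abelian MvPolynomial Finset
open scoped BigOperators

universe u

namespace Summit.Ventures.HSemireg.ObstructionLocus.BlockModel

variable {K : Type u} [CommRing K] {n : ℕ}

/-! ## Generic transports -/

section Transport

variable {A : Type u} [CommRing A]

/-- Transport of `Ext^m(J, J)` along an equality of ideals. -/
noncomputable def extCongrOfEq {J J' : Ideal A} (h : J = J') (m : ℕ) :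
    Ext.{u} (ModuleCat.of A ↥J) (ModuleCat.of A ↥J) m ≃ₗ[A] Ext.{u} (ModuleCat.of A ↥J') (ModuleCat.of A ↥J') m := by
  subst h; exact LinearEquiv.refl _ _

/-- Dependent functions on a `Unique` index type: evaluation at the default index. -/
def piUniqueEquiv {α : Type} [Unique α] (φ : α → Type u) [∀ a, AddCommGroup (φ a)] [∀ a, Module A (φ a)] :
    ((a : α) → φ a) ≃ₗ[A] φ default :=
  { Equiv.piUnique φ with
    map_add' := fun _ _ => rfl
    map_smul' := fun _ _ => rfl }

/-- Currying a dependent function on a binary product, second factor first. -/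
def piProdSwapEquiv {T C : Type} (φ : T × C → Type u) [∀ p, AddCommGroup (φ p)] [∀ p, Module A (φ p)] :
    ((p : T × C) → φ p) ≃ₗ[A] ((c : C) → (t : T) → φ (t, c)) where
  toFun f c t := f (t, c)
  invFun g p := g p.2 p.1
  map_add' _ _ := rfl
  map_smul' _ _ := rfl
  left_inv _ := rfl
  right_inv _ := rfl

/-- `Hom_A(A, A) = A` on `Ext⁰` of the unit ideal: `Ext⁰_A(⊤, ⊤) ≃ₗ[A] A ⧸ ⊥`. -/
noncomputable def extZeroTopEquiv :
    Ext.{u} (ModuleCat.of A ↥(⊤ : Ideal A)) (ModuleCat.of A ↥(⊤ : Ideal A)) 0 ≃ₗ[A] A ⧸ (⊥ : Ideal A) :=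
  (Ext.linearEquiv₀ (R := A)).trans
    ((ModuleCat.homLinearEquiv (S := A)).trans
      ((LinearEquiv.arrowCongr (Submodule.topEquiv : (⊤ : Ideal A) ≃ₗ[A] A)
          (Submodule.topEquiv : (⊤ : Ideal A) ≃ₗ[A] A)).trans
        ((LinearMap.ringLmapEquivSelf A A A).trans (Submodule.quotEquivOfEqBot (⊥ : Ideal A) rfl).symm)))

end Transport

/-! ## Branch tuples and their ideals -/

section Tuples

variable {ι : Type} (B : Blocks ι n)

/-- A BRANCH TUPLE of the block model: one branch datum `t_i = (a_i, b_i)` (`a_i ∈ S_i`, `b_i ∈ S_i ∖ a_i`) in EVERY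
block `S_i` — a choice of one component `B_i = V(x_{a_i}, x_{b_i}) × 𝔸` per block, with its ordering (file XIX's
`Branch` of the one-block structure `Blocks.single S_i`). -/
abbrev BranchTuple : Type := (i : ι) → Branch (Blocks.single (B.S i) (B.nonempty i))

variable (K) in
/-- The ideal of a branch tuple: `J_τ = Σ_i (x_{b_i}, x_{a_i})` (cutting out `⋂_i B_i`). -/
noncomputable abbrev tupleIdeal (τ : BranchTuple B) : Ideal (MvPolynomial (Fin n) K) :=
  ⨆ i, Ideal.span {(X (τ i).1.2.2 : MvPolynomial (Fin n) K), X (τ i).1.2.1}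

/-- **The count**: `#(branch tuples) = Π_i |S_i| (|S_i| − 1)` (file XIX's `card_branch` per block). -/
theorem card_branchTuple [Fintype ι] [DecidableEq ι] :
    Fintype.card (BranchTuple B) = ∏ i, (B.S i).card * ((B.S i).card - 1) := by
  rw [Fintype.card_pi]
  refine Finset.prod_congr rfl fun i _ => ?_
  rw [card_branch]
  simp [Blocks.single]

/-- Blocks of size `2` (the point type `K₂ ⊔ ⋯ ⊔ K₂`, e.g. the triple point of a (GEN) design in `E⁶`): `2^r` branch
tuples — the rank-`2^r` point term (`8` for `r = 3`). -/
theorem card_branchTuple_of_card_eq_two [Fintype ι] [DecidableEq ι] (h2 : ∀ i, (B.S i).card = 2) :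
    Fintype.card (BranchTuple B) = 2 ^ Fintype.card ι := by
  rw [card_branchTuple, Finset.prod_congr rfl fun i _ => by rw [h2 i], Finset.prod_const, Finset.card_univ]

/-- With no blocks the tuple ideal is `0`. -/
theorem tupleIdeal_of_isEmpty [IsEmpty ι] (τ : BranchTuple B) : tupleIdeal K B τ = ⊥ := by
  simp [tupleIdeal]

variable [DecidableEq ι] (i₀ : ι)

/-- Splitting a branch tuple at the block `i₀`: `τ ↦ (τ i₀, τ|_{j ≠ i₀})`, the second component a branch tuple of
the restricted block structure `M′` (file XXVII's `Blocks.restrict`). -/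
def tupleSplit : BranchTuple B ≃ Branch (Blocks.single (B.S i₀) (B.nonempty i₀)) × BranchTuple (B.restrict (· ≠ i₀)) :=
  Equiv.piSplitAt i₀ (fun i => Branch (Blocks.single (B.S i) (B.nonempty i)))

/-- The first component of the splitting. -/
theorem tupleSplit_apply_fst (τ : BranchTuple B) : (tupleSplit B i₀ τ).1 = τ i₀ := rfl

/-- The second component of the splitting. -/
theorem tupleSplit_apply_snd (τ : BranchTuple B) (j : {j // j ≠ i₀}) : (tupleSplit B i₀ τ).2 j = τ j := rfl

/-- The joined tuple at `i₀`. -/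
theorem tupleSplit_symm_apply_self (p : Branch (Blocks.single (B.S i₀) (B.nonempty i₀)) × BranchTuple (B.restrict (· ≠ i₀))) :
    (tupleSplit B i₀).symm p i₀ = p.1 := by
  rw [← tupleSplit_apply_fst B i₀ ((tupleSplit B i₀).symm p), Equiv.apply_symm_apply]

/-- The joined tuple off `i₀`. -/
theorem tupleSplit_symm_apply_of_ne (p : Branch (Blocks.single (B.S i₀) (B.nonempty i₀)) × BranchTuple (B.restrict (· ≠ i₀)))
    (j : {j // j ≠ i₀}) : (tupleSplit B i₀).symm p j = p.2 j := by
  rw [← tupleSplit_apply_snd B i₀ ((tupleSplit B i₀).symm p) j, Equiv.apply_symm_apply]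

/-- **The ideal of a joined tuple**: `J_{(t, τ′)} = (x_b, x_a) + J_{τ′}`. -/
theorem tupleIdeal_symm_tupleSplit (t : Branch (Blocks.single (B.S i₀) (B.nonempty i₀)))
    (τ' : BranchTuple (B.restrict (· ≠ i₀))) :
    tupleIdeal K B ((tupleSplit B i₀).symm (t, τ')) =
      Ideal.span {(X t.1.2.2 : MvPolynomial (Fin n) K), X t.1.2.1} ⊔ tupleIdeal K (B.restrict (· ≠ i₀)) τ' := by
  rw [tupleIdeal, iSup_split_single _ i₀, tupleSplit_symm_apply_self]
  congr 1
  rw [tupleIdeal, iSup_subtype']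
  refine iSup_congr fun j => ?_
  rw [tupleSplit_symm_apply_of_ne]

/-- **Re-indexing** `Π_τ R ⧸ J_τ ≃ₗ[R] Π_{τ′} Π_{t ∈ Br(S_{i₀})} R ⧸ ((x_b, x_a) + J_{τ′})` along the splitting at `i₀`. -/
noncomputable def tupleSplitQuotEquiv :
    ((τ : BranchTuple B) → MvPolynomial (Fin n) K ⧸ tupleIdeal K B τ) ≃ₗ[MvPolynomial (Fin n) K]
      ((τ' : BranchTuple (B.restrict (· ≠ i₀))) → (t : Branch (Blocks.single (B.S i₀) (B.nonempty i₀))) →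
        MvPolynomial (Fin n) K ⧸
          (Ideal.span {(X t.1.2.2 : MvPolynomial (Fin n) K), X t.1.2.1} ⊔ tupleIdeal K (B.restrict (· ≠ i₀)) τ')) :=
  ((LinearEquiv.piCongrLeft' (MvPolynomial (Fin n) K)
      (fun τ : BranchTuple B => MvPolynomial (Fin n) K ⧸ tupleIdeal K B τ) (tupleSplit B i₀)).trans
    (piProdSwapEquiv (A := MvPolynomial (Fin n) K)
      (fun p => MvPolynomial (Fin n) K ⧸ tupleIdeal K B ((tupleSplit B i₀).symm p)))).trans
    (LinearEquiv.piCongrRight fun τ' => LinearEquiv.piCongrRight fun t =>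
      Submodule.quotEquivOfEq _ _ (tupleIdeal_symm_tupleSplit (K := K) B i₀ t τ'))

end Tuples

/-! ## The inductive step: one more block -/

section Step

variable {ι : Type} [Fintype ι] [DecidableEq ι] (B : Blocks ι n) (i₀ : ι) {a₀ : Fin n} (ha₀ : a₀ ∈ B.S i₀) (k : ℕ)
  (hV : ∀ (Y : ModuleCat.{u} (MvPolynomial (Fin n) K))
    (e : Ext.{u} (ModuleCat.of (MvPolynomial (Fin n) K) ↥(otherIdeal (K := K) B i₀)) Y (k + 1)), e = 0)

/-- The coefficient module `E_k = Ext^k_R(V, I_M)` of Step 1. -/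
noncomputable abbrev EK : Type u :=
  Ext.{u} (ModuleCat.of (MvPolynomial (Fin n) K) ↥(otherIdeal (K := K) B i₀))
    (ModuleCat.of (MvPolynomial (Fin n) K) ↥(blockIdeal K (B.S i₀) ⊓ otherIdeal (K := K) B i₀)) k

/-- `E′_k = Ext^k_R(V, V)`. -/
noncomputable abbrev EPrimeK : Type u :=
  Ext.{u} (ModuleCat.of (MvPolynomial (Fin n) K) ↥(otherIdeal (K := K) B i₀))
    (ModuleCat.of (MvPolynomial (Fin n) K) ↥(otherIdeal (K := K) B i₀)) k

omit [Fintype ι] [DecidableEq ι] in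
/-- Under `extPiEquiv`, the range of `Φ^*` on `Ext^k(V^S, I)` is the range of `Φᵀ` on `E_k`-valued vectors. -/
theorem map_range_extPrecomp_eq_degree :
    (LinearMap.range (extPrecomp (S := devissage (B.S i₀) (otherIdeal (K := K) B i₀) ha₀)
        (ModuleCat.of (MvPolynomial (Fin n) K) ↥(blockIdeal K (B.S i₀) ⊓ otherIdeal (K := K) B i₀)) k)).map
      (extPiEquiv ↥(otherIdeal (K := K) B i₀) ↥((B.S i₀).erase a₀)
          (ModuleCat.of (MvPolynomial (Fin n) K) ↥(blockIdeal K (B.S i₀) ⊓ otherIdeal (K := K) B i₀)) k :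
        _ →ₗ[MvPolynomial (Fin n) K] (↥((B.S i₀).erase a₀) → EK (K := K) B i₀ k)) =
      LinearMap.range (scalarMatrix (EK (K := K) B i₀ k) (fun b a => hbMatrix (K := K) (B.S i₀) a₀ a b)) := by
  have key : ∀ ζ, extPiEquiv ↥(otherIdeal (K := K) B i₀) ↥((B.S i₀).erase a₀)
      (ModuleCat.of (MvPolynomial (Fin n) K) ↥(blockIdeal K (B.S i₀) ⊓ otherIdeal (K := K) B i₀)) k
      (extPrecomp (S := devissage (B.S i₀) (otherIdeal (K := K) B i₀) ha₀) _ k ζ) =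
      scalarMatrix (EK (K := K) B i₀ k) (fun b a => hbMatrix (K := K) (B.S i₀) a₀ a b)
        (extPiEquiv ↥(otherIdeal (K := K) B i₀) ↥(B.S i₀) _ k ζ) := by
    intro ζ
    funext b
    rw [extPrecomp_apply, devissage_f, extPiEquiv_precomp_scalarMatrix, scalarMatrix_apply]
  apply le_antisymm
  · rintro _ ⟨_, ⟨ζ, rfl⟩, rfl⟩
    exact ⟨_, (key ζ).symm⟩
  · rintro _ ⟨w, rfl⟩
    refine ⟨extPrecomp _ k ((extPiEquiv ↥(otherIdeal (K := K) B i₀) ↥(B.S i₀) _ k).symm w), ⟨_, rfl⟩, ?_⟩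
    rw [LinearEquiv.coe_coe, key, LinearEquiv.apply_symm_apply]

include hV in
/-- **Step 1** (degree `k + 1`): `Ext^{k+1}_R(I_M, I_M) ≃ₗ[R] E_k^{S∖a₀} ⧸ range Φᵀ`, since `Ext^{k+1}(V^S, I_M) = 0`. -/
noncomputable def stepOneK :
    Ext.{u} (ModuleCat.of (MvPolynomial (Fin n) K) ↥(blockIdeal K (B.S i₀) ⊓ otherIdeal (K := K) B i₀))
        (ModuleCat.of (MvPolynomial (Fin n) K) ↥(blockIdeal K (B.S i₀) ⊓ otherIdeal (K := K) B i₀)) (k + 1)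
      ≃ₗ[MvPolynomial (Fin n) K]
        ((↥((B.S i₀).erase a₀) → EK (K := K) B i₀ k) ⧸
          LinearMap.range (scalarMatrix (EK (K := K) B i₀ k) (fun b a => hbMatrix (K := K) (B.S i₀) a₀ a b))) :=
  (extCokernelEquiv (devissage_shortExact_twoBlocks (K := K) B i₀ ha₀) _ k (fun e => by
      rw [← (extPiEquiv ↥(otherIdeal (K := K) B i₀) ↥(B.S i₀) _ (k + 1)).symm_apply_apply e]
      have : extPiEquiv ↥(otherIdeal (K := K) B i₀) ↥(B.S i₀) _ (k + 1) e = 0 :=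
        funext fun a => hV _ _
      rw [this, map_zero])).symm.trans
    (Submodule.Quotient.equiv _ _ _ (map_range_extPrecomp_eq_degree (K := K) B i₀ ha₀ k))

omit [Fintype ι] [DecidableEq ι] in
/-- Under `extCoPiEquiv`, the range of `Φ_*` on `Ext^k(V, V^{S∖a₀})` is the range of `Φ` on `E′_k`-valued vectors. -/
theorem map_range_extPostcomp_eq_degree :
    (LinearMap.range (extPostcomp (S := devissage (B.S i₀) (otherIdeal (K := K) B i₀) ha₀)
        (ModuleCat.of (MvPolynomial (Fin n) K) ↥(otherIdeal (K := K) B i₀)) k)).map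
      (extCoPiEquiv ↥(otherIdeal (K := K) B i₀) ↥(B.S i₀)
          (ModuleCat.of (MvPolynomial (Fin n) K) ↥(otherIdeal (K := K) B i₀)) k :
        _ →ₗ[MvPolynomial (Fin n) K] (↥(B.S i₀) → EPrimeK (K := K) B i₀ k)) =
      LinearMap.range (scalarMatrix (EPrimeK (K := K) B i₀ k) (hbMatrix (K := K) (B.S i₀) a₀)) := by
  have key : ∀ ζ, extCoPiEquiv ↥(otherIdeal (K := K) B i₀) ↥(B.S i₀)
      (ModuleCat.of (MvPolynomial (Fin n) K) ↥(otherIdeal (K := K) B i₀)) k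
      (extPostcomp (S := devissage (B.S i₀) (otherIdeal (K := K) B i₀) ha₀) _ k ζ) =
      scalarMatrix (EPrimeK (K := K) B i₀ k) (hbMatrix (K := K) (B.S i₀) a₀)
        (extCoPiEquiv ↥(otherIdeal (K := K) B i₀) ↥((B.S i₀).erase a₀) _ k ζ) := by
    intro ζ
    funext b
    rw [extPostcomp_apply, devissage_f, extCoPiEquiv_postcomp_scalarMatrix, scalarMatrix_apply]
  apply le_antisymm
  · rintro _ ⟨_, ⟨ζ, rfl⟩, rfl⟩
    exact ⟨_, (key ζ).symm⟩
  · rintro _ ⟨w, rfl⟩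
    refine ⟨extPostcomp _ k ((extCoPiEquiv ↥(otherIdeal (K := K) B i₀) ↥((B.S i₀).erase a₀) _ k).symm w),
      ⟨_, rfl⟩, ?_⟩
    rw [LinearEquiv.coe_coe, key, LinearEquiv.apply_symm_apply]

include hV in
/-- **Step 2** (degree `k`): `E_k ≃ₗ[R] P^S ⧸ range Φ` for ANY description `e : Ext^k_R(V, V) ≃ₗ[R] P` of the top `Ext`
of the other blocks, since `Ext^{k+1}(V, V^{S∖a₀}) = 0`. -/
noncomputable def stepTwoK {P : Type u} [AddCommGroup P] [Module (MvPolynomial (Fin n) K) P]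
    (e : EPrimeK (K := K) B i₀ k ≃ₗ[MvPolynomial (Fin n) K] P) :
    EK (K := K) B i₀ k ≃ₗ[MvPolynomial (Fin n) K]
      ((↥(B.S i₀) → P) ⧸ LinearMap.range (scalarMatrix P (hbMatrix (K := K) (B.S i₀) a₀))) :=
  ((extCokernelEquiv' (devissage_shortExact_twoBlocks (K := K) B i₀ ha₀)
      (ModuleCat.of (MvPolynomial (Fin n) K) ↥(otherIdeal (K := K) B i₀)) k (fun e' => hV _ e')).symm.trans
    (Submodule.Quotient.equiv _ _ _ (map_range_extPostcomp_eq_degree (K := K) B i₀ ha₀ k))).trans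
    (quotRangeCongr (hbMatrix (K := K) (B.S i₀) a₀) e)

include hV in
/-- **Steps 3–5 for a product description** `e : Ext^k_R(V, V) ≃ₗ[R] Π_{τ′} R ⧸ J_{τ′}`:
`Ext^{k+1}_R(I_M, I_M) ≃ₗ[R] Π_{τ′} Π_{t ∈ Br(S)} R ⧸ ((x_{t.b}, x_{t.a}) + J_{τ′})` — flatten (XXXIII), commute `Y` with
the product (XXXIII), and file XXXV's `yQuotEquiv` (base change XXXIV + core XXXII) factor by factor. -/
noncomputable def extSuccEquivOfPi {τ' : Type} [Fintype τ'] [DecidableEq τ']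
    (J : τ' → Ideal (MvPolynomial (Fin n) K))
    (e : EPrimeK (K := K) B i₀ k ≃ₗ[MvPolynomial (Fin n) K] ((t' : τ') → MvPolynomial (Fin n) K ⧸ J t')) :
    Ext.{u} (ModuleCat.of (MvPolynomial (Fin n) K) ↥(blockIdeal K (B.S i₀) ⊓ otherIdeal (K := K) B i₀))
        (ModuleCat.of (MvPolynomial (Fin n) K) ↥(blockIdeal K (B.S i₀) ⊓ otherIdeal (K := K) B i₀)) (k + 1)
      ≃ₗ[MvPolynomial (Fin n) K]
        ((t' : τ') → (t : Branch (Blocks.single (B.S i₀) (B.nonempty i₀))) →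
          MvPolynomial (Fin n) K ⧸ (Ideal.span {(X t.1.2.2 : MvPolynomial (Fin n) K), X t.1.2.1} ⊔ J t')) :=
  (((stepOneK (K := K) B i₀ ha₀ k hV).trans
    (quotRangeCongr (fun b a => hbMatrix (K := K) (B.S i₀) a₀ a b) (stepTwoK (K := K) B i₀ ha₀ k hV e))).trans
    (flattenEquiv _ _).symm).trans
    ((quotRelYPiEquiv _ _ (fun t' => MvPolynomial (Fin n) K ⧸ J t')).trans
      (LinearEquiv.piCongrRight fun t' => yQuotEquiv (K := K) B i₀ ha₀ (J t')))

end Step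

/-! ## The induction on the number of blocks -/

/-- **Base**: with NO blocks `I_M = R`, and `Ext⁰_R(R, R) = R = Π_{τ} R ⧸ J_τ` (one empty tuple, `J = 0`). -/
noncomputable def extTopEquivOfIsEmpty {ι : Type} [IsEmpty ι] (B : Blocks ι n) :
    Ext.{u} (ModuleCat.of (MvPolynomial (Fin n) K) ↥(arrIdeal K B))
        (ModuleCat.of (MvPolynomial (Fin n) K) ↥(arrIdeal K B)) 0
      ≃ₗ[MvPolynomial (Fin n) K] ((τ : BranchTuple B) → MvPolynomial (Fin n) K ⧸ tupleIdeal K B τ) :=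
  ((extCongrOfEq (arrIdeal_eq_top_of_isEmpty (K := K) B) 0).trans
    (extZeroTopEquiv (A := MvPolynomial (Fin n) K))).trans
    ((Submodule.quotEquivOfEq _ _ (tupleIdeal_of_isEmpty (K := K) B default).symm).trans
      (piUniqueEquiv (A := MvPolynomial (Fin n) K)
        (fun τ : BranchTuple B => MvPolynomial (Fin n) K ⧸ tupleIdeal K B τ)).symm)

/-- **The induction** (template: file XXX's `hasProjectiveDimensionLT_of_card`): for every block model with `k`
blocks, `Ext^k_R(I_M, I_M) ≃ₗ[R] Π_{τ} R ⧸ J_τ`. -/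
theorem nonempty_extTopEquiv_of_card (k : ℕ) :
    ∀ {ι : Type} [Fintype ι] [DecidableEq ι] (B : Blocks ι n), Fintype.card ι = k →
      Nonempty (Ext.{u} (ModuleCat.of (MvPolynomial (Fin n) K) ↥(arrIdeal K B))
          (ModuleCat.of (MvPolynomial (Fin n) K) ↥(arrIdeal K B)) k
        ≃ₗ[MvPolynomial (Fin n) K] ((τ : BranchTuple B) → MvPolynomial (Fin n) K ⧸ tupleIdeal K B τ)) := by
  induction k with
  | zero =>
    intro ι _ _ B hk
    haveI : IsEmpty ι := Fintype.card_eq_zero_iff.1 hk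
    exact ⟨extTopEquivOfIsEmpty (K := K) B⟩
  | succ k ih =>
    intro ι _ _ B hk
    obtain ⟨i₀⟩ : Nonempty ι := Fintype.card_pos_iff.1 (by omega)
    have hcard : Fintype.card {i // i ≠ i₀} = k := by
      rw [Fintype.card_subtype, Finset.filter_ne', Finset.card_erase_of_mem (Finset.mem_univ _),
        Finset.card_univ, hk]
      rfl
    obtain ⟨a₀, ha₀⟩ := B.nonempty i₀
    obtain ⟨e⟩ := ih (B.restrict (· ≠ i₀)) hcard
    have hV : ∀ (Y : ModuleCat.{u} (MvPolynomial (Fin n) K))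
        (e : Ext.{u} (ModuleCat.of (MvPolynomial (Fin n) K) ↥(otherIdeal (K := K) B i₀)) Y (k + 1)), e = 0 :=
      fun Y e => by
        haveI := ext_arrIdeal_subsingleton_of_card_lt (K := K) (B.restrict (· ≠ i₀)) Y
          (i := k + 1) (by rw [hcard]; exact Nat.lt_succ_self k)
        exact Subsingleton.elim _ _
    exact ⟨((extCongrOfEq (arrIdeal_eq_blockIdeal_inf_restrict (K := K) B i₀) (k + 1)).trans
      (extSuccEquivOfPi (K := K) B i₀ ha₀ k hV (tupleIdeal K (B.restrict (· ≠ i₀))) e)).trans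
      (tupleSplitQuotEquiv (K := K) B i₀).symm⟩

section Main

variable {ι : Type} [Fintype ι] [DecidableEq ι] (B : Blocks ι n)

/-- **EXT-NOTE §6.B(c) IN TOP DEGREE AT EVERY CROSSING GERM, over any commutative ring**:
`Ext^r_R(I_M, I_M) ≃ₗ[R] Π_{τ} R ⧸ Σ_i (x_{b_i}, x_{a_i})` over the branch tuples `τ = ((a_i, b_i))_{i}` of the `r`-block
model `M` (`r = #blocks`) — «`𝓔xt^r(I_Z, I_Z)` at a point through which `r` translates pass has rank `Π_i |S_i|(|S_i|−1)`
on `⋂_i B_i` for every choice of one component `B_i ⊂ W + t_i` per translate, and nothing else».  (The equivalence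
is CHOSEN (`Classical.choice`) from the inductive construction `nonempty_extTopEquiv_of_card`; the explicit one-step
equivalence, natural in a description of the other blocks' top `Ext`, is `extSuccEquivOfPi`.) -/
noncomputable def extTopEquiv :
    Ext.{u} (ModuleCat.of (MvPolynomial (Fin n) K) ↥(arrIdeal K B))
        (ModuleCat.of (MvPolynomial (Fin n) K) ↥(arrIdeal K B)) (Fintype.card ι)
      ≃ₗ[MvPolynomial (Fin n) K] ((τ : BranchTuple B) → MvPolynomial (Fin n) K ⧸ tupleIdeal K B τ) :=
  Classical.choice (nonempty_extTopEquiv_of_card (K := K) _ B rfl)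

/-- The same with the number of blocks as an explicit numeral `r` (e.g. `r = 3`: the rank-`8` point term of
`𝓔xt³(I_Z, I_Z)` at the triple point `K₂ ⊔ K₂ ⊔ K₂` of a (GEN) design in `E⁶`). -/
noncomputable def extEquivOfCardEq {r : ℕ} (hr : Fintype.card ι = r) :
    Ext.{u} (ModuleCat.of (MvPolynomial (Fin n) K) ↥(arrIdeal K B))
        (ModuleCat.of (MvPolynomial (Fin n) K) ↥(arrIdeal K B)) r
      ≃ₗ[MvPolynomial (Fin n) K] ((τ : BranchTuple B) → MvPolynomial (Fin n) K ⧸ tupleIdeal K B τ) :=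
  Classical.choice (nonempty_extTopEquiv_of_card (K := K) r B hr)

end Main

/-! ### At a point of a (GEN) arrangement through which `r` translates pass -/

/-- **EXT-NOTE §6.B(c), top degree, at a point `q` of a (GEN) arrangement `Z_T` lying on exactly `r` translates**
(file XXIV's block structure `Blocks.ofPoint q T`, blocks = the coincidence sets `S_t(q)`, `r = #(through q T)`):
`Ext^r` of the local ideal with itself is `Π_{τ} R ⧸ J_τ` over the choices `τ` of one branch `(a_t, b_t) ⊂ S_t(q)` per
translate through `q` (the étale-local identification itself stays prose). -/
noncomputable def extTopEquiv_ofPoint {G : Type} [DecidableEq G] (q : Fin n → G) (T : Finset (Fin n → G))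
    (hGEN : ∀ t ∈ T, ∀ t' ∈ T, t ≠ t' → ∀ k, t k ≠ t' k) {r : ℕ} (hr : (through q T).card = r) :
    Ext.{u} (ModuleCat.of (MvPolynomial (Fin n) K) ↥(arrIdeal K (Blocks.ofPoint q T hGEN)))
        (ModuleCat.of (MvPolynomial (Fin n) K) ↥(arrIdeal K (Blocks.ofPoint q T hGEN))) r
      ≃ₗ[MvPolynomial (Fin n) K]
        ((τ : BranchTuple (Blocks.ofPoint q T hGEN)) → MvPolynomial (Fin n) K ⧸ tupleIdeal K (Blocks.ofPoint q T hGEN) τ) :=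
  extEquivOfCardEq (K := K) (Blocks.ofPoint q T hGEN) (by rw [Fintype.card_coe]; exact hr)

end Summit.Ventures.HSemireg.ObstructionLocus.BlockModel
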